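import Mathlib
import Summits.Ventures.PercRepro2.LocRows2
import Summits.Ventures.PercRepro2.LocSym
import Summits.Ventures.PercRepro2.LocPairing

/-!
# The piece-confined pairing (PAIR-combo) for the principal up-set
(blind cell PercRepro2, night-4; census 2026-08-23T22:3xZ–23:0xZ, own code, kit j207045)

For the principal up-set `{S ∣ o ∈ S}` the pairing of `LocPairing` can be asked with the recoloured
set `A = diff(ζ, ψ ζ) = Agree(ζ, τ ζ)` confined to the two o-pieces: with `P₁ = piece ζ l o` (the
source's piece) and `P₂ = piece (τ ζ) l o` (= the image's piece, pieces being colour-symmetric),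

  `touches (P₁ ∩ P₂) ∪ touches {o} ⊆ A ⊆ touches P₁ ∪ touches P₂`

(`ComboRel`): `ψ` recolours every edge at `o` and at the common part of the two pieces and nothing
outside their union. **(PAIR-combo)** (`PairCombo`) is (PAIR-𝓤) at the principal up-set with this
extra clause; it implies (PAIR-𝓤) (`pairU_of_pairCombo`), hence (LOC-sym), (LOC-𝓤), 2′DOM2 and
(BASE) on every fibre. Census (exact): a (PAIR-combo) involution exists in every `(l, h, o)` case
with `M₀ ≠ ∅` at `n = 5` (460), `n = 6` (5,633, all 112 graphs) and `n = 7`, `m ≤ 9` (26,292, all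
218 graphs; kit j207045). Statements and the reduction only.
-/

namespace Summit.Ventures.PercRepro2

namespace LocRows

open Hull

variable {V : Type*} {E : Type*} [Fintype E] [DecidableEq E]

open scoped Classical

variable (ends : E → Sym2 V)

/-- The piece-confined clause on the AGREEMENT set of a pair: every edge at `o` and at the common part
of the two o-pieces is an agreement edge, and every agreement edge touches one of the two pieces. -/
def ComboRel (l o : V) (ζ₁ ζ₂ : Config E) : Prop :=
  (∀ e, e ∈ touches ends (piece ends ζ₁ l o ∩ piece ends ζ₂ l o) → ζ₁ e = ζ₂ e) ∧
  (∀ e, e ∈ touches ends {o} → ζ₁ e = ζ₂ e) ∧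
  (∀ e, ζ₁ e = ζ₂ e → e ∈ touches ends (piece ends ζ₁ l o) ∨ e ∈ touches ends (piece ends ζ₂ l o))

omit [Fintype E] [DecidableEq E] in
/-- The clause is symmetric. -/
lemma ComboRel.symm {l o : V} {ζ₁ ζ₂ : Config E} (h : ComboRel ends l o ζ₁ ζ₂) :
    ComboRel ends l o ζ₂ ζ₁ :=
  ⟨fun e he => (h.1 e (by rwa [Set.inter_comm])).symm, fun e he => (h.2.1 e he).symm,
    fun e he => (h.2.2 e he.symm).symm⟩

/-- **(PAIR-combo)**: a pairing of `M₀ = {h ∉ H_l, o ∈ B_side}` (the principal source set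
`srcU ends l h {S ∣ o ∈ S}`) whose pairs satisfy `PairRel` and the piece-confined clause. -/
def PairCombo (l h o : V) : Prop :=
  ∃ τ : {ζ // ζ ∈ srcU ends l h {S : Set V | o ∈ S}} → {ζ // ζ ∈ srcU ends l h {S : Set V | o ∈ S}},
    Function.Involutive τ ∧ ∀ x, PairRel ends l x.1 (τ x).1 ∧ ComboRel ends l o x.1 (τ x).1

/-- (PAIR-combo) ⟹ (PAIR-𝓤) at the principal up-set. -/
theorem pairU_of_pairCombo (l h o : V) (hp : PairCombo ends l h o) :
    PairU ends l h {S : Set V | o ∈ S} := by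
  obtain ⟨τ, hτ, hrel⟩ := hp
  exact ⟨τ, hτ, fun x => (hrel x).1⟩

/-- (PAIR-combo) ⟹ (LOC-sym) at the principal up-set. -/
theorem locSym_of_pairCombo (l h o : V) (hp : PairCombo ends l h o) :
    LocSym ends l h {S : Set V | o ∈ S} :=
  locSym_of_pairU ends l h _ (pairU_of_pairCombo ends l h o hp)

/-- (PAIR-combo) over all finite graphs and markings. -/
def PairCombo_all : Prop :=
  ∀ (V E : Type) [Fintype V] [DecidableEq V] [Fintype E] [DecidableEq E] (ends : E → Sym2 V)
    (l h o : V), l ≠ h → o ≠ l → o ≠ h → PairCombo ends l h o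

end LocRows

end Summit.Ventures.PercRepro2
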